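import Summits.HodgeConjecture.HodgeConjecture.Theorems.Ring2AbelianAllLefschetzPencilsGraded
import Summits.HodgeConjecture.HodgeConjecture.Theorems.Ring2AbelianAllAndreWeilPencilsCMPower
import HarnessLib

/-!
# Ring 2 · sub-cell AbelianAll (ALL ABELIAN VARIETIES), André axis — ab-andre-1 part VIII: the WEIL COLUMN fed by
# conjecture `B` for pencil total spaces — `(W_E) ∧ (5)_{2n} ⟹[h₈] R∞`, and `(W_E)₃ ∧ (5)_6 ⟹[h₈] WeilSixfolds`

HONEST FRAMING (page 1, verbatim): **research route, not a corollary; conditional on HC_CM plus one named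
minimal statement.** Cell line: research route conditional on HC_CM; not a corollary; Q11.4-sentence-2
already refuted in dim ≥ 3. Nothing in this file proves an open case of the Hodge conjecture: the targets
`WeilTypeLadder.WeilClassesImaginaryQuadratic` (R∞), `Theses.SevenfoldWeilCensus.WeilSixfolds` (stmt-2524) and
`WeilTypeLadder.NonsplitSixfolds` are reached CONDITIONALLY on the typed OPEN nodes `(W_E)ₙ`
(`CMPowerAnchoredCompactWeilPencilsAt n`, ab-andre-2 part IX) and the GRADED Lefschetz nodes `(5)_d`
(`LefschetzBCMPointedPencilsAtRelDim d`) / `(5∀)_d` (`LefschetzBCompactPencilsAtRelDim d`) of part VII, modulo the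
NAMED FACT `h₈ = Abdulali1994_invariantCycles_of_lefschetzStandard` (a BINDER, displayed). `HC_CM`
(`Theses.RankFourFaces.CMAbelianHodge`) is ABSENT from every theorem here (ab-andre-2 IX: an `E`-power anchor makes
it idle on the Weil column). No statement is re-filed; items 16267 / 16268 / 2524 stay open. Seat
`pub-hodge-ring2-ab-andre-1`, gen 4.

## What this part adds (composition BY NAME of part VII with ab-andre-2 part IX; count once)

ab-andre-2 IX proved `(∀ n ≥ 2, (W_E)ₙ) ∧ (∀ n ≥ 2, T@2n) ⟹ R∞` and `(W_E)₃ ∧ T@6 ⟹ WeilSixfolds` with the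
TRANSPORT input `T@d = CMAnchoredTransportAtRelDim d`, and the same with the repaired β-Lefschetz input `(β′)_d`.
Part VII proved `(5)_d ⟹[h₈] T@d` (`cmAnchoredTransportAtRelDim_of_abdulali_of_lefschetzBCMPointedPencilsAtRelDim`).
Composing: **Grothendieck's conjecture `B` for the `(2n+1)`-dimensional total spaces of CM-pointed compact pencils of
abelian `2n`-folds, for all `n ≥ 2`, gives — granted `h₈` and the habitat `(W_E)` — the algebraicity of the Weil
classes for every imaginary quadratic field (R∞)**; the smallest instance: **`(W_E)₃ ∧ (5)_6 ⟹[h₈] WeilSixfolds`**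
(conjecture `B` for SEVEN-dimensional total spaces of pencils of abelian sixfolds). In print `(5)_d` costs MORE than
`(β′)_d` (RING2-MAP AA1.22/AA1.24: `(5)_d ⟺ (β′)_d ∧ OddΛ_F(d)` modulo Künnemann 1993 and Deligne; the odd-degree
clause is non-vacuous from `d = 3` on), so these rows are the DOMINATING versions of ab-andre-2's fact-free
`(β′)`-rows, recorded for the concordance (LEAD L14.2 N43 / C4), not as an improvement on them.

References: [Abdulali1994FamiliesAV, (1.1), Thm. 5.5, pp. 1122–1123]; [Grothendieck1968, §3]; [Kleiman1968AlgebraicCycles,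
§2]; [vanGeemen1994HodgeAV, Thm. 4.3, 5.12]; [Andre1996Motifs, §6.3 (p. 33)]; [Weil1977HodgeRing].
-/

noncomputable section

set_option linter.dupNamespace false

namespace Summit.HodgeConjecture.HodgeConjecture.Ring2.AbelianAll

open CategoryTheory AlgebraicGeometry
open Literature.AlgebraicGeometry Literature.AlgebraicGeometry.Motives
open Literature.AlgebraicGeometry.HodgeTheory
open Literature.AlgebraicGeometry.Abdulali1994 (Abdulali1994_invariantCycles_of_lefschetzStandard)
open Summit.HodgeConjecture.HodgeConjecture
open Summit.HodgeConjecture.HodgeConjecture.Theses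
open Summit.HodgeConjecture.HodgeConjecture.WeilTypeLadder (WeilClassesImaginaryQuadratic NonsplitSixfolds
  nonsplitSixfolds_of_weilSixfolds)

/-! ## §A R∞ from the Weil habitat and conjecture `B` for pencil total spaces, modulo `h₈` -/

/-- **`(∀ n ≥ 2, (W_E)ₙ) ∧ (∀ n ≥ 2, (5)_{2n}) ⟹ R∞`, granted `h₈`; NO `HC_CM`.** Conjecture `B` for the total
spaces of CM-pointed compact pencils of abelian `2n`-folds (all `n ≥ 2`) gives the Weil classes for every imaginary
quadratic field. [cite: Abdulali1994FamiliesAV, pp. 1122–1123] [cite: vanGeemen1994HodgeAV, Thm. 4.3]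
[cite: Andre1996Motifs, §6.3 (p. 33)] -/
theorem weilClassesImaginaryQuadratic_of_abdulali_of_cmPowerWeilPencils_of_lefschetzBCMPointedPencilsAtRelDim
    (h₈ : Abdulali1994_invariantCycles_of_lefschetzStandard)
    (hW : ∀ n, 2 ≤ n → CMPowerAnchoredCompactWeilPencilsAt n)
    (hB : ∀ n, 2 ≤ n → LefschetzBCMPointedPencilsAtRelDim (2 * n)) :
    WeilClassesImaginaryQuadratic :=
  weilClassesImaginaryQuadratic_of_cmPowerWeilPencils_of_transport hW
    fun n hn ↦ cmAnchoredTransportAtRelDim_of_abdulali_of_lefschetzBCMPointedPencilsAtRelDim h₈ (hB n hn)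

/-- The same from the blanket graded node `(5∀)_{2n}` (conjecture `B` for ALL compact pencils of abelian
`2n`-folds). [cite: Abdulali1994FamiliesAV, pp. 1122–1123] [cite: Grothendieck1968, §3 p. 196 (B(X))] -/
theorem weilClassesImaginaryQuadratic_of_abdulali_of_cmPowerWeilPencils_of_lefschetzBCompactPencilsAtRelDim
    (h₈ : Abdulali1994_invariantCycles_of_lefschetzStandard)
    (hW : ∀ n, 2 ≤ n → CMPowerAnchoredCompactWeilPencilsAt n)
    (hB : ∀ n, 2 ≤ n → LefschetzBCompactPencilsAtRelDim (2 * n)) :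
    WeilClassesImaginaryQuadratic :=
  weilClassesImaginaryQuadratic_of_abdulali_of_cmPowerWeilPencils_of_lefschetzBCMPointedPencilsAtRelDim h₈ hW
    fun n hn ↦ lefschetzBCMPointedPencilsAtRelDim_of_lefschetzBCompactPencilsAtRelDim (hB n hn)

/-- Ungraded form: `(∀ n ≥ 2, (W_E)ₙ) ∧ (5) ⟹ R∞`, granted `h₈` (`(5) = LefschetzBCMPointedPencils`, all relative
dimensions at once). [cite: Abdulali1994FamiliesAV, pp. 1122–1123] [cite: vanGeemen1994HodgeAV, Thm. 4.3] -/
theorem weilClassesImaginaryQuadratic_of_abdulali_of_cmPowerWeilPencils_of_lefschetzBCMPointedPencils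
    (h₈ : Abdulali1994_invariantCycles_of_lefschetzStandard)
    (hW : ∀ n, 2 ≤ n → CMPowerAnchoredCompactWeilPencilsAt n) (hB : LefschetzBCMPointedPencils) :
    WeilClassesImaginaryQuadratic :=
  weilClassesImaginaryQuadratic_of_abdulali_of_cmPowerWeilPencils_of_lefschetzBCMPointedPencilsAtRelDim h₈ hW
    fun n _ ↦ lefschetzBCMPointedPencils_iff_forall_atRelDim.1 hB (2 * n)

/-- From the SUMMIT side (sanity / on-path reading): the Hodge conjecture itself supplies every `(5)_{2n}`
(part VII, fact-free), so `(W_E) ∧ HodgeConjecture ⟹[h₈] R∞` — of course weaker than the direct on-path theorem for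
R∞; recorded only to show the row's inputs are cases of the summit. [folklore] -/
theorem weilClassesImaginaryQuadratic_of_abdulali_of_cmPowerWeilPencils_of_hodgeConjecture
    (h₈ : Abdulali1994_invariantCycles_of_lefschetzStandard)
    (hW : ∀ n, 2 ≤ n → CMPowerAnchoredCompactWeilPencilsAt n) (h : _root_.HodgeConjecture) :
    WeilClassesImaginaryQuadratic :=
  weilClassesImaginaryQuadratic_of_abdulali_of_cmPowerWeilPencils_of_lefschetzBCMPointedPencilsAtRelDim h₈ hW
    fun n _ ↦ lefschetzBCMPointedPencilsAtRelDim_of_hodgeConjecture h (2 * n)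

/-! ## §B The smallest instance: Weil SIXFOLDS from conjecture `B` on SEVENFOLD total spaces, modulo `h₈` -/

/-- **`(W_E)₃ ∧ (5)_6 ⟹ WeilSixfolds`, granted `h₈`; NO `HC_CM`.** Conjecture `B` for the seven-dimensional total
spaces of CM-pointed compact pencils of abelian sixfolds gives item stmt-2524 (Weil classes on all abelian sixfolds
of Weil type), given the `E`-power-anchored Weil habitat at `n = 3`.
[cite: Abdulali1994FamiliesAV, pp. 1122–1123] [cite: vanGeemen1994HodgeAV, Thm. 4.3 and 5.12]
[cite: Andre1996Motifs, Lemme 6.3.3 (p. 33)] -/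
theorem weilSixfolds_of_abdulali_of_cmPowerWeilPencilsAt_of_lefschetzBCMPointedPencilsAtRelDim_six
    (h₈ : Abdulali1994_invariantCycles_of_lefschetzStandard)
    (hW : CMPowerAnchoredCompactWeilPencilsAt 3) (hB : LefschetzBCMPointedPencilsAtRelDim 6) :
    Theses.SevenfoldWeilCensus.WeilSixfolds :=
  weilSixfolds_of_cmPowerWeilPencilsAt_of_cmAnchoredTransportAtRelDim_six hW
    (cmAnchoredTransportAtRelDim_of_abdulali_of_lefschetzBCMPointedPencilsAtRelDim h₈ hB)

/-- The same from the blanket node `(5∀)_6`. [cite: Abdulali1994FamiliesAV, pp. 1122–1123]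
[cite: Grothendieck1968, §3 p. 196 (B(X))] -/
theorem weilSixfolds_of_abdulali_of_cmPowerWeilPencilsAt_of_lefschetzBCompactPencilsAtRelDim_six
    (h₈ : Abdulali1994_invariantCycles_of_lefschetzStandard)
    (hW : CMPowerAnchoredCompactWeilPencilsAt 3) (hB : LefschetzBCompactPencilsAtRelDim 6) :
    Theses.SevenfoldWeilCensus.WeilSixfolds :=
  weilSixfolds_of_abdulali_of_cmPowerWeilPencilsAt_of_lefschetzBCMPointedPencilsAtRelDim_six h₈ hW
    (lefschetzBCMPointedPencilsAtRelDim_of_lefschetzBCompactPencilsAtRelDim hB)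

/-- In particular the NON-SPLIT Weil sixfolds. [cite: vanGeemen1994HodgeAV, 5.12]
[cite: Abdulali1994FamiliesAV, pp. 1122–1123] -/
theorem nonsplitSixfolds_of_abdulali_of_cmPowerWeilPencilsAt_of_lefschetzBCMPointedPencilsAtRelDim_six
    (h₈ : Abdulali1994_invariantCycles_of_lefschetzStandard)
    (hW : CMPowerAnchoredCompactWeilPencilsAt 3) (hB : LefschetzBCMPointedPencilsAtRelDim 6) : NonsplitSixfolds :=
  nonsplitSixfolds_of_weilSixfolds
    (weilSixfolds_of_abdulali_of_cmPowerWeilPencilsAt_of_lefschetzBCMPointedPencilsAtRelDim_six h₈ hW hB)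

/-- KIND statement in the Frame idiom: given `h₈` and `(W_E)₃`, `(5)_6` ALONE gives `WeilSixfolds` — `HC_CM` idle
on this row. [folklore] -/
theorem weilSixfolds_cmIdle_of_abdulali_of_cmPowerWeilPencilsAt
    (h₈ : Abdulali1994_invariantCycles_of_lefschetzStandard) (hW : CMPowerAnchoredCompactWeilPencilsAt 3) :
    LefschetzBCMPointedPencilsAtRelDim 6 → Theses.SevenfoldWeilCensus.WeilSixfolds :=
  fun hB ↦ weilSixfolds_of_abdulali_of_cmPowerWeilPencilsAt_of_lefschetzBCMPointedPencilsAtRelDim_six h₈ hW hB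

#print axioms weilClassesImaginaryQuadratic_of_abdulali_of_cmPowerWeilPencils_of_lefschetzBCMPointedPencilsAtRelDim
#print axioms weilSixfolds_of_abdulali_of_cmPowerWeilPencilsAt_of_lefschetzBCMPointedPencilsAtRelDim_six
#print axioms nonsplitSixfolds_of_abdulali_of_cmPowerWeilPencilsAt_of_lefschetzBCMPointedPencilsAtRelDim_six

end Summit.HodgeConjecture.HodgeConjecture.Ring2.AbelianAll

end
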